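import Literature.MathematicalPhysics.StatisticalMechanics.TorusFRDRealSpace
import HarnessLib

/-!
# Proof of the torus finite-range decomposition with improved regularity (`TorusFRD_holds`)

Topic `Literature/MathematicalPhysics/StatisticalMechanics`.  This file discharges the named fact
`GradientFRD.TorusFRD` (`TorusFiniteRangeDecomposition.lean`; Buchholz, J. Funct. Anal. 275 (2018),
Thm 2.4, scalar case) by assembling the construction of the preceding files:

* base decomposition (Thm 2.3): telescoping low-pass polynomial pieces in the multiplier variable
  (`Literature/Analysis/Fourier/TelescopingLowPass*.lean`, `TorusFRDMultipliers.lean`);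
* scale mixing (Prop 3.1: `FRDScaleMixing.lean`, `TorusFRDFinalMultipliers.lean`);
* subtract/re-add the reference decomposition (proof of Thm 2.4: `finalMult`);
* kernels `𝒞_{A,k} = mulKernel f_k` (`TorusFRDRealSpace.lean`) with (o) zero average and evenness,
  (i) positivity, (ii) `∇*A∇ (Σ_k 𝒞_{A,k}) ⋆ φ = φ`, (iii) finite range (`frdKernel_eq_const`), (iv) the
  real-space bounds, (v) the two-sided Fourier bounds with the improved decay of the `A`-derivatives.

The decomposition is translation invariant by construction (convolution kernels); the reference
operator is `A₀ = Ω₀·1 ∈ 𝓛(ω₀,Ω₀)` in place of the source's `−Δ` (same argument).  Everything is proved;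
no named facts; net effect: the fact `TorusFRD d` holds for every `d` (its hypothesis `3 ≤ d` inside).

## References
* S. Buchholz, *Finite range decomposition for Gaussian measures with improved regularity*,
  J. Funct. Anal. 275 (2018) 1674–1711, Thm 2.4 (with Thm 2.3, Prop 3.1, App. A) [Buchholz2016].
-/

noncomputable section

namespace Literature.MathematicalPhysics.StatisticalMechanics.GradientFRD

open Finset Polynomial Literature.Analysis.Fourier Literature.Probability.LatticeModels
open scoped Real BigOperators

section Kernels

variable {d M : ℕ} [NeZero M]

/-! ## Linearity of the multiplier kernels -/

/-- `mulKernel` is additive in the multiplier. [cite: Buchholz2016, §2 (2.15)] -/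
theorem mulKernel_finset_sum {ι : Type*} (S : Finset ι) (g : ι → (Fin d → ZMod M) → ℝ) (x : Fin d → ZMod M) :
    mulKernel (fun κ => ∑ i ∈ S, g i κ) x = ∑ i ∈ S, mulKernel (g i) x := by
  rw [mulKernel_eq_sum]
  simp_rw [mulKernel_eq_sum, Finset.sum_mul]
  rw [Finset.sum_comm]

/-- `mulKernel` is homogeneous in the multiplier. [cite: Buchholz2016, §2 (2.15)] -/
theorem mulKernel_const_mul (c : ℝ) (m : (Fin d → ZMod M) → ℝ) (x : Fin d → ZMod M) :
    mulKernel (fun κ => c * m κ) x = c * mulKernel m x := by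
  rw [mulKernel_eq_sum, mulKernel_eq_sum, Finset.mul_sum]
  exact sum_congr rfl fun κ _ => by ring

/-! ## Finite range of the kernels (Thm 2.4 (iii)) -/

/-- The base multiplier extended by zero is a polynomial in the symbol beyond which the kernel is the
constant `−c_j(0)/M^d`: for `j ≤ k ≤ N` and `|x|_∞ ≥ L^k/2`. [cite: Buchholz2016, Thm 2.4 (iii), §3 (p. 9)] -/
theorem mulKernel_baseMultZ_eq {Ω₀ : ℝ} {A : Matrix (Fin d) (Fin d) ℝ} (hA : A.IsSymm) {L N k j : ℕ} (hL : 5 ≤ L)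
    (hj1 : 1 ≤ j) (hjk : j ≤ k) (hkN : k ≤ N) (x : Fin d → ZMod M) (hx : ((L : ℝ) ^ k) / 2 ≤ (supNorm x : ℝ)) :
    mulKernel (fun κ => if κ = 0 then 0 else baseMult Ω₀ L N j A κ) x =
      -((piecePoly (band d Ω₀) L j).eval 0) / (M : ℝ) ^ d := by
  refine mulKernel_poly_eq_const hA (piecePoly (band d Ω₀) L j) (fun κ hκ => ?_) (if_pos rfl) x ?_
  · rw [if_neg hκ, baseMult, piece_eq_eval (hjk.trans hkN)]
  · -- `deg c_j < |x|_∞` from `2 (deg + 1) ≤ L^j + 1 ≤ L^k + 1 ≤ 2 |x|_∞ + 1`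
    have h1 := two_mul_natDegree_piecePoly_lt (band d Ω₀) L j hL hj1
    have h2 : L ^ j ≤ L ^ k := Nat.pow_le_pow_right (by omega) hjk
    have h3 : ((L ^ k : ℕ) : ℝ) ≤ 2 * (supNorm x : ℝ) := by push_cast; linarith
    have h4 : L ^ k ≤ 2 * supNorm x := by exact_mod_cast h3
    omega

/-- The mixed multiplier extended by zero and its kernel's constant value beyond the range:
`mulKernel([κ≠0] 𝒟̂^ν_k(A',κ))(x) = −mix(c_j(0))/M^d` for `k ≤ N`, `|x|_∞ ≥ L^k/2`.
[cite: Buchholz2016, Prop 3.1 (3.3)] -/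
theorem mulKernel_mixMultZ_eq {Ω₀ : ℝ} {A : Matrix (Fin d) (Fin d) ℝ} (hA : A.IsSymm) (ν : ℕ) {L N k : ℕ}
    (hL : 5 ≤ L) (hkN : k ≤ N) (x : Fin d → ZMod M) (hx : ((L : ℝ) ^ k) / 2 ≤ (supNorm x : ℝ)) :
    mulKernel (fun κ => if κ = 0 then 0 else mixMult Ω₀ ν L N k A κ) x =
      -(mix (L : ℝ) (gammaExp d ν) N (fun j => (piecePoly (band d Ω₀) L j).eval 0) k) / (M : ℝ) ^ d := by
  have hfun : (fun κ : Fin d → ZMod M => if κ = 0 then (0 : ℝ) else mixMult Ω₀ ν L N k A κ) =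
      fun κ => ∑ j ∈ Finset.Icc 1 k, mixCoeff (L : ℝ) (gammaExp d ν) N k j *
        (if κ = 0 then 0 else baseMult Ω₀ L N j A κ) := by
    funext κ
    split_ifs with h
    · simp
    · rfl
  rw [hfun, mulKernel_finset_sum]
  simp_rw [mulKernel_const_mul]
  rw [mix, neg_div, Finset.sum_div, ← Finset.sum_neg_distrib]
  refine sum_congr rfl fun j hj => ?_
  rw [Finset.mem_Icc] at hj
  rw [mulKernel_baseMultZ_eq hA hL hj.1 hj.2 hkN x hx]
  ring

/-- The constant value `M_k` of `𝒞_{A,k}` beyond the range (independent of `A`):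
`M_k = −[(1−θ) mix^ñ(c_j(0)) + θ mix^n(c_j(0))]/M^d`. [cite: Buchholz2016, Thm 2.4 (iii)] -/
def rangeConst (d : ℕ) (Ω₀ : ℝ) (n ñ : ℕ) (K : ℝ) (L N k : ℕ) : ℝ :=
  -((1 - thetaC d ñ K L) * mix (L : ℝ) (gammaExp d ñ) N (fun j => (piecePoly (band d Ω₀) L j).eval 0) k +
      thetaC d ñ K L * mix (L : ℝ) (gammaExp d n) N (fun j => (piecePoly (band d Ω₀) L j).eval 0) k) /
    (((L ^ N : ℕ) : ℝ)) ^ d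

/-- `M_k ≤ 0`. [cite: Buchholz2016, Thm 2.4 (iii) ("M_k … positive semi-definite", here with the sign of (3.3))] -/
theorem rangeConst_nonpos (hd : 2 ≤ d) {Ω₀ : ℝ} (hΩ : 0 < Ω₀) (n ñ : ℕ) {K : ℝ} (hK : 1 ≤ K) {L N k : ℕ} (hL : 5 ≤ L)
    (hkN : k ≤ N) : rangeConst d Ω₀ n ñ K L N k ≤ 0 := by
  have hB := (band_pos_of (d := d) hΩ (by omega)).1
  have hθ := thetaC_pos_le (d := d) (ñ := ñ) hK (show 1 ≤ L by omega)
  have hL' : (5 : ℝ) ≤ (L : ℝ) := by exact_mod_cast hL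
  have hP : ∀ j, 1 ≤ j → j ≤ k → 0 ≤ (piecePoly (band d Ω₀) L j).eval 0 := fun j _ hj =>
    piecePoly_eval_zero_nonneg hB L (N := N) (hj.trans hkN)
  have h1 : 0 ≤ mix (L : ℝ) (gammaExp d ñ) N (fun j => (piecePoly (band d Ω₀) L j).eval 0) k :=
    sum_nonneg fun j hj => mul_nonneg (mixCoeff_nonneg hL' (one_le_gammaExp hd ñ) N k j)
      (hP j (Finset.mem_Icc.1 hj).1 (Finset.mem_Icc.1 hj).2)
  have h2 : 0 ≤ mix (L : ℝ) (gammaExp d n) N (fun j => (piecePoly (band d Ω₀) L j).eval 0) k :=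
    sum_nonneg fun j hj => mul_nonneg (mixCoeff_nonneg hL' (one_le_gammaExp hd n) N k j)
      (hP j (Finset.mem_Icc.1 hj).1 (Finset.mem_Icc.1 hj).2)
  unfold rangeConst
  rw [neg_div, neg_nonpos]
  refine div_nonneg ?_ (by positivity)
  have : 0 ≤ 1 - thetaC d ñ K L := by linarith [hθ.2]
  exact add_nonneg (mul_nonneg this h1) (mul_nonneg hθ.1.le h2)

/-- **Finite range (Thm 2.4 (iii))**: for `1 ≤ k ≤ N` and `|x|_∞ ≥ L^k/2`, `𝒞_{A,k}(x) = M_k`.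
[cite: Buchholz2016, Thm 2.4 (iii)] -/
theorem frdKernel_eq_const {ω₀ Ω₀ : ℝ} (hωΩ : ω₀ ≤ Ω₀) {A : Matrix (Fin d) (Fin d) ℝ} (hA : IsElliptic ω₀ Ω₀ A)
    (n ñ : ℕ) (K : ℝ) {L N k : ℕ} (hL : 5 ≤ L) (hM : M = L ^ N) (hkN : k ≤ N) (x : Fin d → ZMod M)
    (hx : ((L : ℝ) ^ k) / 2 ≤ (supNorm x : ℝ)) : frdKernel Ω₀ n ñ K L N k A x = rangeConst d Ω₀ n ñ K L N k := by
  have hA₀ : (refOp d Ω₀).IsSymm := (refOp_isElliptic (d := d) hωΩ).1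
  have hfun : (fMultZ Ω₀ n ñ K L N k A : (Fin d → ZMod M) → ℝ) = fun κ =>
      ∑ i : Fin 3, ![(1 : ℝ), -thetaC d ñ K L, thetaC d ñ K L] i *
        (![fun κ => if κ = 0 then 0 else mixMult Ω₀ ñ L N k A κ,
           fun κ => if κ = 0 then 0 else mixMult Ω₀ ñ L N k (refOp d Ω₀) κ,
           fun κ => if κ = 0 then 0 else mixMult Ω₀ n L N k (refOp d Ω₀) κ] i : (Fin d → ZMod M) → ℝ) κ := by
    funext κ
    simp only [fMultZ, finalMult, Fin.sum_univ_three, Matrix.cons_val_zero, Matrix.cons_val_one,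
      Matrix.cons_val_two, Matrix.tail_cons, Matrix.head_cons]
    split_ifs <;> ring
  rw [frdKernel, hfun, mulKernel_finset_sum]
  simp only [Fin.sum_univ_three, Matrix.cons_val_zero, Matrix.cons_val_one, Matrix.cons_val_two,
    Matrix.tail_cons, Matrix.head_cons, mulKernel_const_mul]
  rw [mulKernel_mixMultZ_eq hA.1 ñ hL hkN x hx, mulKernel_mixMultZ_eq hA₀ ñ hL hkN x hx,
    mulKernel_mixMultZ_eq hA₀ n hL hkN x hx, rangeConst, hM]
  push_cast
  ring

/-! ## Fourier coefficients of the kernels and their directional derivatives -/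

/-- `𝓕(𝒞_{A,k})(κ) = f_k(A,κ)` (and `0` at `κ = 0`). [cite: Buchholz2016, §2 (2.15)–(2.17)] -/
theorem fourierCoeff_frdKernel (Ω₀ : ℝ) (n ñ : ℕ) (K : ℝ) (L N k : ℕ) (A : Matrix (Fin d) (Fin d) ℝ)
    (κ : Fin d → ZMod M) : fourierCoeff (frdKernel Ω₀ n ñ K L N k A) κ = ((fMultZ Ω₀ n ñ K L N k A κ : ℝ) : ℂ) :=
  fourierCoeff_mulKernel (fMultZ_neg Ω₀ n ñ K L N k A) κ

/-- Iterated derivatives commute with the embedding `ℝ → ℂ` for functions smooth on an open set. [folklore] -/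
private theorem iteratedDeriv_ofReal_comp {g : ℝ → ℝ} {U : Set ℝ} (hU : IsOpen U) (hg : ContDiffOn ℝ ⊤ g U) :
    ∀ (ℓ : ℕ) (x : ℝ), x ∈ U → iteratedDeriv ℓ (fun s => ((g s : ℝ) : ℂ)) x = ((iteratedDeriv ℓ g x : ℝ) : ℂ) := by
  intro ℓ
  induction ℓ with
  | zero => intro x _; simp
  | succ ℓ ih =>
    intro x hx
    have hev : (iteratedDeriv ℓ fun s => ((g s : ℝ) : ℂ)) =ᶠ[nhds x] fun s => ((iteratedDeriv ℓ g s : ℝ) : ℂ) := by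
      filter_upwards [hU.mem_nhds hx] with s hs using ih s hs
    rw [iteratedDeriv_succ, hev.deriv_eq]
    have hdiffU : DifferentiableOn ℝ (iteratedDeriv ℓ g) U := by
      have h1 : DifferentiableOn ℝ (iteratedDerivWithin ℓ g U) U :=
        hg.differentiableOn_iteratedDerivWithin (WithTop.coe_lt_top _) hU.uniqueDiffOn
      exact h1.congr fun y hy => (iteratedDerivWithin_of_isOpen hU hy).symm
    have hdiff : DifferentiableAt ℝ (iteratedDeriv ℓ g) x := hdiffU.differentiableAt (hU.mem_nhds hx)
    rw [(hdiff.hasDerivAt.ofReal_comp).deriv, iteratedDeriv_succ]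

/-- **Directional derivatives of the Fourier coefficients**: for `κ ≠ 0`,
`∂_s^ℓ 𝓕(𝒞_{A+sȦ,k})(κ)|_{s=0} = ∂_s^ℓ f_k(A+sȦ,κ)|_{s=0}` (as a complex number).
[cite: Buchholz2016, Thm 2.4 (v)] -/
theorem iteratedDeriv_fourierCoeff_frdKernel {ω₀ Ω₀ : ℝ} (hω : 0 < ω₀) {A : Matrix (Fin d) (Fin d) ℝ}
    (hA : IsElliptic ω₀ Ω₀ A) {B' : Matrix (Fin d) (Fin d) ℝ} (hB' : IsUnitSymm B') (n ñ : ℕ) (K : ℝ) (L N k : ℕ)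
    {κ : Fin d → ZMod M} (hκ : κ ≠ 0) (ℓ : ℕ) :
    iteratedDeriv ℓ (fun s : ℝ => fourierCoeff (frdKernel Ω₀ n ñ K L N k (A + s • B')) κ) 0 =
      ((iteratedDeriv ℓ (fun s : ℝ => finalMult Ω₀ n ñ K L N k (A + s • B') κ) 0 : ℝ) : ℂ) := by
  have hfun : (fun s : ℝ => fourierCoeff (frdKernel Ω₀ n ñ K L N k (A + s • B')) κ) =
      fun s => ((finalMult Ω₀ n ñ K L N k (A + s • B') κ : ℝ) : ℂ) := by
    funext s; rw [fourierCoeff_frdKernel, fMultZ_of_ne _ _ _ _ _ _ _ _ hκ]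
  rw [hfun]
  exact iteratedDeriv_ofReal_comp isOpen_Ioo (contDiffOn_finalMult hω hA hB' n ñ K L N k κ) ℓ 0
    (Set.mem_Ioo.2 ⟨by linarith, hω⟩)

end Kernels

/-! ## The theorem -/

/-- `L` odd with `L > 3` gives `L ≥ 5`. [cite: Buchholz2016, Thm 2.4 ("L > 3 odd")] -/
theorem five_le_of_odd_of_three_lt {L : ℕ} (hodd : Odd L) (h3 : 3 < L) : 5 ≤ L := by
  obtain ⟨r, hr⟩ := hodd; omega

/-- **Buchholz's finite-range decomposition with improved regularity on the torus, scalar case**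
(discharge of the named fact `TorusFRD`). [cite: Buchholz2016, Thm 2.4] -/
theorem TorusFRD_holds : ∀ d : ℕ, TorusFRD d := by
  intro d hd ω₀ Ω₀ hω hωΩ n ñ hnñ
  have hd2 : 2 ≤ d := by omega
  have hd1 : 1 ≤ d := by omega
  have hΩ : 0 < Ω₀ := hω.trans hωΩ
  -- constants
  obtain ⟨K, hK1, hK⟩ := exists_mixMult_ratio d hd2 hω hωΩ ñ
  have hK0 : 0 < K := by linarith
  obtain ⟨Uñ, hUñ0, hUñ⟩ := exists_mixMult_deriv_upper d hd2 hω hωΩ ñ 0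
  obtain ⟨Un, hUn0, hUn⟩ := exists_mixMult_deriv_upper d hd2 hω hωΩ n 0
  have hUℓ' : ∀ ℓ : ℕ, ∃ U, 0 ≤ U ∧ ∀ (L N M : ℕ) [NeZero M], 5 ≤ L → 1 ≤ N → M = L ^ N →
      ∀ A : Matrix (Fin d) (Fin d) ℝ, IsElliptic ω₀ Ω₀ A → ∀ B' : Matrix (Fin d) (Fin d) ℝ, IsUnitSymm B' →
        ∀ k, 1 ≤ k → k ≤ N + 1 → ∀ κ : Fin d → ZMod M, κ ≠ 0 →
          |iteratedDeriv ℓ (fun s : ℝ => mixMult Ω₀ ñ L N k (A + s • B') κ) 0| ≤ U * (L : ℝ) ^ (2 * k) ∧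
          ∀ j, InShell L j κ → j < k →
            |iteratedDeriv ℓ (fun s : ℝ => mixMult Ω₀ ñ L N k (A + s • B') κ) 0| ≤
              U * (L : ℝ) ^ (2 * (d + ñ) + 1) * (L : ℝ) ^ (2 * j) / (L : ℝ) ^ ((k - j) * gammaExp d ñ) :=
    fun ℓ => exists_mixMult_deriv_upper d hd2 hω hωΩ ñ ℓ
  choose Uℓ hUℓ0 hUℓ using hUℓ'
  have hRS' : ∀ ℓ s : ℕ, ∃ C, 0 ≤ C ∧ (s ≤ n → ∀ (L N M : ℕ) [NeZero M], 5 ≤ L → 1 ≤ N → M = L ^ N →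
      ∀ A : Matrix (Fin d) (Fin d) ℝ, IsElliptic ω₀ Ω₀ A → ∀ B' : Matrix (Fin d) (Fin d) ℝ, IsUnitSymm B' →
        ∀ K : ℝ, 1 ≤ K → ∀ k, 1 ≤ k → k ≤ N + 1 → ∀ α : Fin d → ℕ, ∑ i, α i = s → ∀ x : Fin d → ZMod M,
          |iteratedDeriv ℓ (fun t : ℝ => iterDiff α (frdKernel Ω₀ n ñ K L N k (A + t • B')) x) 0| ≤
            C / (L : ℝ) ^ ((k - 1) * (d - 2 + s))) := by
    intro ℓ s
    by_cases hs : s ≤ n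
    · obtain ⟨C, hC0, hC⟩ := exists_frdKernel_realSpace_le d hd hω hωΩ hnñ.le ℓ s hs
      exact ⟨C, hC0, fun _ => hC⟩
    · exact ⟨0, le_rfl, fun h => absurd h hs⟩
  choose Cr hCr0 hCr using hRS'
  have hc0 : 0 < cLow d Ω₀ / K := div_pos (cLow_pos hd1 hΩ) hK0
  refine ⟨fun L N M A k => if hM : M = 0 then fun _ => 0 else
      (haveI : NeZero M := ⟨hM⟩; frdKernel Ω₀ n ñ K L N k A),
    fun L N k => rangeConst d Ω₀ n ñ K L N k, fun α ℓ => Cr ℓ (∑ i, α i), cLow d Ω₀ / K, 2 * Uñ + Un, fun ℓ => Uℓ ℓ,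
    hc0, ?_⟩
  intro L hLodd hL3 N hN M instM hM A hA
  have hL : 5 ≤ L := five_le_of_odd_of_three_lt hLodd hL3
  have hL' : (5 : ℝ) ≤ (L : ℝ) := by exact_mod_cast hL
  have hL1 : (1 : ℝ) ≤ L := by linarith
  have hL0 : (0 : ℝ) < L := by linarith
  have hM0 : M ≠ 0 := NeZero.ne M
  have hA₀ : IsElliptic ω₀ Ω₀ (refOp d Ω₀) := refOp_isElliptic hωΩ.le
  have h0unit : IsUnitSymm (0 : Matrix (Fin d) (Fin d) ℝ) :=
    ⟨Matrix.isSymm_zero, fun z => by simp [sum_nonneg, sq_nonneg]⟩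
  have hθ := thetaC_pos_le (d := d) (ñ := ñ) hK1 (show 1 ≤ L by omega)
  simp only [dif_neg hM0]
  -- the nonnegativity of the multipliers (positivity of the decomposition)
  have hratio : ∀ k, 1 ≤ k → k ≤ N + 1 → ∀ κ : Fin d → ZMod M, κ ≠ 0 →
      |mixMult Ω₀ ñ L N k (refOp d Ω₀) κ| ≤ K * (L : ℝ) ^ (2 * (d + ñ) + 1) * mixMult Ω₀ ñ L N k A κ :=
    fun k hk1 hk κ hκ => hK L N M hL hN hM A (refOp d Ω₀) hA hA₀ k hk1 hk κ hκ
  have hfge : ∀ k, 1 ≤ k → k ≤ N + 1 → ∀ κ : Fin d → ZMod M, κ ≠ 0 →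
      thetaC d ñ K L * mixMult Ω₀ n L N k (refOp d Ω₀) κ ≤ finalMult Ω₀ n ñ K L N k A κ ∧
        0 ≤ finalMult Ω₀ n ñ K L N k A κ :=
    fun k hk1 hk κ hκ => finalMult_ge hd2 hω hωΩ hK1 hL N k hκ (hratio k hk1 hk κ hκ)
  have hfZnn : ∀ k, 1 ≤ k → k ≤ N + 1 → ∀ κ : Fin d → ZMod M, 0 ≤ fMultZ Ω₀ n ñ K L N k A κ := by
    intro k hk1 hk κ
    by_cases hκ : κ = 0
    · rw [hκ, fMultZ_zero]
    · rw [fMultZ_of_ne _ _ _ _ _ _ _ _ hκ]; exact (hfge k hk1 hk κ hκ).2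
  -- `θ · c_low = c / L^{2(d+ñ)+1}`
  have hθc : thetaC d ñ K L * cLow d Ω₀ = cLow d Ω₀ / K / (L : ℝ) ^ (2 * (d + ñ) + 1) := by
    unfold thetaC; field_simp
  refine ⟨?_, ?_, ?_, ?_, ?_, ?_⟩
  · -- (o) zero average and evenness
    intro k _ _
    refine ⟨?_, fun x => mulKernel_neg _ x⟩
    rw [frdKernel, sum_mulKernel (fMultZ_neg Ω₀ n ñ K L N k A), fMultZ_zero]
  · -- (i) positivity
    intro k hk1 hk φ _
    exact mulKernel_posSemidef (hfZnn k hk1 hk) φ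
  · -- (ii) the decomposition identity
    intro φ hφ
    have hsum : (fun x => ∑ k ∈ Finset.Icc 1 (N + 1), frdKernel Ω₀ n ñ K L N k A x) =
        mulKernel (fun κ : Fin d → ZMod M => ∑ k ∈ Finset.Icc 1 (N + 1), fMultZ Ω₀ n ñ K L N k A κ) := by
      funext x; rw [mulKernel_finset_sum]; rfl
    rw [hsum]
    refine ellOp_conv_mulKernel hA.1 (fun κ => ?_) (fun κ hκ => ?_) φ hφ
    · exact sum_congr rfl fun k _ => fMultZ_neg Ω₀ n ñ K L N k A κ
    · have : ∑ k ∈ Finset.Icc 1 (N + 1), fMultZ Ω₀ n ñ K L N k A κ = 1 / symbR A κ := by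
        rw [← sum_finalMult hω hωΩ hA n ñ K L N hκ]
        exact sum_congr rfl fun k _ => fMultZ_of_ne _ _ _ _ _ _ _ _ hκ
      rw [this, one_div, inv_mul_cancel₀ (symbR_pos hA hω hκ).ne']
  · -- (iii) finite range
    intro k _ hk
    exact ⟨rangeConst_nonpos hd2 hΩ n ñ hK1 hL hk, fun x hx => frdKernel_eq_const hωΩ.le hA n ñ K hL hM hk x hx⟩
  · -- (iv) regularity and the real-space bounds
    intro k hk1 hk B' hB'
    refine ⟨⟨ω₀, hω, fun x => contDiffOn_frdKernel hω hA hB' n ñ K L N k x⟩, ?_⟩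
    intro α hα ℓ x
    exact hCr ℓ (∑ i, α i) hα L N M hL hN hM A hA B' hB' K hK1 k hk1 hk α rfl x
  · -- (v) the Fourier bounds
    intro k hk1 hk j κ hκ hj
    have hre : (fourierCoeff (frdKernel Ω₀ n ñ K L N k A) κ).re = finalMult Ω₀ n ñ K L N k A κ := by
      rw [fourierCoeff_frdKernel, Complex.ofReal_re, fMultZ_of_ne _ _ _ _ _ _ _ _ hκ]
    have hnorm : ‖fourierCoeff (frdKernel Ω₀ n ñ K L N k A) κ‖ = |finalMult Ω₀ n ñ K L N k A κ| := by
      rw [fourierCoeff_frdKernel, Complex.norm_real, Real.norm_eq_abs, fMultZ_of_ne _ _ _ _ _ _ _ _ hκ]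
    rw [hre, hnorm]
    have hfk := hfge k hk1 hk κ hκ
    -- bounds for the three mixed multipliers at order zero
    have hDA := hUñ L N M hL hN hM A hA 0 h0unit k hk1 hk κ hκ
    have hDA₀ := hUñ L N M hL hN hM (refOp d Ω₀) hA₀ 0 h0unit k hk1 hk κ hκ
    have hDn := hUn L N M hL hN hM (refOp d Ω₀) hA₀ 0 h0unit k hk1 hk κ hκ
    simp only [iteratedDeriv_zero, smul_zero, add_zero] at hDA hDA₀ hDn
    -- `|f| ≤ |𝒟̂ñ(A)| + θ |𝒟̂ñ(A₀)| + θ |𝒟̂n(A₀)|`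
    have habs : |finalMult Ω₀ n ñ K L N k A κ| ≤ |mixMult Ω₀ ñ L N k A κ| + |mixMult Ω₀ ñ L N k (refOp d Ω₀) κ| +
        |mixMult Ω₀ n L N k (refOp d Ω₀) κ| := by
      unfold finalMult
      calc _ ≤ |mixMult Ω₀ ñ L N k A κ| + thetaC d ñ K L * |mixMult Ω₀ ñ L N k (refOp d Ω₀) κ| +
            thetaC d ñ K L * |mixMult Ω₀ n L N k (refOp d Ω₀) κ| := by
            refine (abs_add_le _ _).trans (add_le_add ((abs_sub _ _).trans (add_le_add le_rfl ?_)) ?_)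
            · rw [abs_mul, abs_of_pos hθ.1]
            · rw [abs_mul, abs_of_pos hθ.1]
        _ ≤ _ := by
            have h1 := abs_nonneg (mixMult Ω₀ ñ L N k (refOp d Ω₀) κ)
            have h2 := abs_nonneg (mixMult Ω₀ n L N k (refOp d Ω₀) κ)
            nlinarith [hθ.2, hθ.1]
    have hpowñ : (L : ℝ) ^ (2 * (d + n) + 1) ≤ (L : ℝ) ^ (2 * (d + ñ) + 1) := pow_le_pow_right₀ hL1 (by omega)
    refine ⟨fun hjk => ⟨?_, ?_⟩, fun hkj => ⟨?_, ?_⟩, fun B' hB' ℓ hℓ => ?_⟩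
    · -- lower bound, `j < k`
      have hlow := mixMult_lower_lt hd2 hω hωΩ hA₀ n hL hN hM hjk hk hκ hj
      calc cLow d Ω₀ / K / (L : ℝ) ^ (2 * (d + ñ) + 1) * (L : ℝ) ^ (2 * j) / (L : ℝ) ^ ((k - j) * (d - 1 + n))
          = thetaC d ñ K L * (cLow d Ω₀ * (L : ℝ) ^ (2 * j) / (L : ℝ) ^ ((k - j) * gammaExp d n)) := by
            rw [← hθc, gammaExp]; ring
        _ ≤ thetaC d ñ K L * mixMult Ω₀ n L N k (refOp d Ω₀) κ := mul_le_mul_of_nonneg_left hlow hθ.1.le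
        _ ≤ finalMult Ω₀ n ñ K L N k A κ := hfk.1
    · -- upper bound, `j < k`
      have e1 := (hDA.2 j hj hjk).trans (div_pow_gammaExp_mono hL1 hnñ.le d k j (by positivity))
      have e2 := (hDA₀.2 j hj hjk).trans (div_pow_gammaExp_mono hL1 hnñ.le d k j (by positivity))
      have e3 : |mixMult Ω₀ n L N k (refOp d Ω₀) κ| ≤
          Un * (L : ℝ) ^ (2 * (d + ñ) + 1) * (L : ℝ) ^ (2 * j) / (L : ℝ) ^ ((k - j) * gammaExp d n) := by
        refine (hDn.2 j hj hjk).trans ?_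
        gcongr
      refine habs.trans ?_
      rw [show (k - j) * (d - 1 + n) = (k - j) * gammaExp d n from rfl]
      have : (2 * Uñ + Un) * (L : ℝ) ^ (2 * (d + ñ) + 1) * (L : ℝ) ^ (2 * j) / (L : ℝ) ^ ((k - j) * gammaExp d n) =
          Uñ * (L : ℝ) ^ (2 * (d + ñ) + 1) * (L : ℝ) ^ (2 * j) / (L : ℝ) ^ ((k - j) * gammaExp d n) +
          Uñ * (L : ℝ) ^ (2 * (d + ñ) + 1) * (L : ℝ) ^ (2 * j) / (L : ℝ) ^ ((k - j) * gammaExp d n) +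
          Un * (L : ℝ) ^ (2 * (d + ñ) + 1) * (L : ℝ) ^ (2 * j) / (L : ℝ) ^ ((k - j) * gammaExp d n) := by ring
      rw [this]
      exact add_le_add (add_le_add e1 e2) e3
    · -- lower bound, `k ≤ j`
      have hlow := mixMult_lower_ge hd2 hω hωΩ hA₀ n hL hM hk1 hkj hκ hj
      calc cLow d Ω₀ / K / (L : ℝ) ^ (2 * (d + ñ) + 1) * (L : ℝ) ^ (2 * k)
          = thetaC d ñ K L * (cLow d Ω₀ * (L : ℝ) ^ (2 * k)) := by rw [← hθc]; ring
        _ ≤ thetaC d ñ K L * mixMult Ω₀ n L N k (refOp d Ω₀) κ := mul_le_mul_of_nonneg_left hlow hθ.1.le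
        _ ≤ finalMult Ω₀ n ñ K L N k A κ := hfk.1
    · -- upper bound, `k ≤ j`
      refine habs.trans ?_
      have : (2 * Uñ + Un) * (L : ℝ) ^ (2 * k) = Uñ * (L : ℝ) ^ (2 * k) + Uñ * (L : ℝ) ^ (2 * k) + Un * (L : ℝ) ^ (2 * k) := by
        ring
      rw [this]
      exact add_le_add (add_le_add hDA.1 hDA₀.1) hDn.1
    · -- derivative bounds, `ℓ ≥ 1`
      rw [iteratedDeriv_fourierCoeff_frdKernel hω hA hB' n ñ K L N k hκ ℓ, Complex.norm_real, Real.norm_eq_abs,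
        iteratedDeriv_finalMult Ω₀ n ñ K L N k A B' κ hℓ]
      have h := hUℓ ℓ L N M hL hN hM A hA B' hB' k hk1 hk κ hκ
      refine ⟨fun hjk => ?_, fun _ => h.1⟩
      have := h.2 j hj hjk
      rwa [show (k - j) * gammaExp d ñ = (k - j) * (d - 1 + ñ) from rfl] at this

end Literature.MathematicalPhysics.StatisticalMechanics.GradientFRD

end
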